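import Summits.BirchSwinnertonDyer.BirchSwinnertonDyer.Theorems.BiquadraticEisensteinDescentHeegnerTwistCouplingInSupplyRoundingPin
import Summits.BirchSwinnertonDyer.BirchSwinnertonDyer.Theorems.BiquadraticEisensteinDescentHeegnerTwistCouplingInSupplyCornersEpOneFact
import HarnessLib

set_option linter.dupNamespace false -- `Summit.BirchSwinnertonDyer.BirchSwinnertonDyer.Theorems.…` (summit = sub)
set_option autoImplicit false

/-!
# Crux `HeegnerTwistCouplingInSupply` (stmt-BirchSwinnertonDyer-21381) — ★★ the corner `W = E_p` for EVERY prime `p ≡ 7 (mod 8)`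
# (no residue-class hypothesis, no density residual), modulo Burungale–Tian ONLY

Route `BiquadraticEisensteinDescent` (cell `pub/bsd-wall`, width seat `bsd-wall-cm-bed-w2` g13; `--supports` 21381, helper). Sequel of
`…RoundingPin` (kernel form of the crux idea `rounding-pin-all-p`, seat 1 g17). The landed corner
`…CornersEpOneFact.cruxOnEpCorner_of_BT` (w3 g12; after `…CornersThreeFacts.cruxOnEpCorner_of_three_facts`, w4 g12) covers the primes
`p ≡ 7 (mod 8)` of the partner ladder — `p ≡ 2 (mod 3)` or `±2 (mod 5)` or `(p/11) = −1` or `(p/19) = −1` or `(p/43) = −1` or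
`(13/p) = −1`, density `63/64` — because its only `p`-dependent input, the CELL DATUM `exists_cellData_p` (primes `q ≡ 3`,
`ℓ ≡ 5 (mod 8)`, `(q/p) = +1`, `(ℓ/p) = −1`, `h(−qℓ) < p`), takes one partner from a FIXED prime. This file supplies the cell datum
for EVERY prime `p ≡ 7 (mod 8)`:

* §1 the class-number-formula lever at `|d| = O(p^{3/2})`: `inv_pi_mul_sqrt_mul_log_lt_of_le_pow_six` (`x ≤ B⁶ p^{3/2}`, tangent of
  `log` at `e²`: `π⁻¹√x log x < p` once `6 < (π/B⁴ − 6/e²)·B·p^{1/4}`), its instance at the rounding bound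
  `7x ≤ (3p + 4⌊√2p⌋ + 4)(4⌊√2p⌋ + 1)`, `p ≥ 1400` (`B = 1.172`, `T = 6.06`), and `classNumber_lt_of_rounding_bound` (Oesterlé
  `h ≤ π⁻¹√|d| log|d|`, tree `classNumber_lt_of_sqrt_mul_log_lt`);
* §2 below `1400`: ONE kernel table per half-range over EVERY `p ≡ 7 (mod 8)` (prime or not; partners `q ∈ {3,11,19,43,59,67,83}`,
  `ℓ ∈ {5,13,29,37,53,61}` = `…PartnerLadderRungs.partnersL_spec`, residues by brute force, `h(−qℓ)` by Cohen's pair counter `BinQF.classNumberCount`) — `exists_cellData_p_of_lt`;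
* §3 ★ `exists_cellData_p_all` — the statement of `exists_cellData_p` WITHOUT its hypothesis `hcase`, for every prime `p ≡ 7 (mod 8)`
  (`p ≥ 1400`: `…RoundingPin.exists_cellPair_bound` + §1; `p < 1400`: §2);
* §4 ★★ `cruxOnEpCornerAllP_of_BT` — the statement of `cruxOnEpCorner_of_BT` with `hcase` DELETED: for EVERY prime `p ≡ 7 (mod 8)`, modulo
  Burungale–Tian's rank-zero `2`-converse ONLY, a Heegner field `K′` of `N(E_p)` with `4 < |d_{K′}|`, `L(E_p^{(d_{K′})}, 1) ≠ 0`,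
  `h(K′) < p`, `p ∤ h(K′)` (proof = w3's, by name: `L_one_ne_zero_congruent`, `exists_witnessField_of`,
  `eq_two_or_eq_of_prime_dvd_conductorNorm_p`); and `cruxOnEpCornerAllP` — the same with the instance binders `[IsElliptic]`,
  `[IsGloballyMinimal]`, `[NeZero N]` DISCHARGED (`isElliptic_congruentNumberCurve`, `isGloballyMinimal_congruentNumberCurve`,
  `conductorNorm_pos_holds`): an honest closed statement about `E_p : y² = x³ − p²x` for every prime `p ≡ 7 (mod 8)`.

HONEST FRAMING: a typed sub-corner on ONE CM family (`j = 1728`, the congruent number twists `E_p`); the crux (all CM `W` of analytic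
rank one in the inert-bad corner; residual C⁺ on the tail) is untouched; BSD is not proved by any of this. THEOREMS ONLY (no definition,
no new named fact, no `sorry`). Supports stmt-BirchSwinnertonDyer-21381.
-/

noncomputable section

namespace Summit.BirchSwinnertonDyer.BirchSwinnertonDyer.Theorems.BiquadraticEisensteinDescentHeegnerTwistCouplingInSupplyRoundingPinCellData

open Literature.NumberTheory.EllipticCurves Literature.NumberTheory.QuadraticFields Literature.NumberTheory.QuadraticFields.Quadratic
open Summit.BirchSwinnertonDyer.BirchSwinnertonDyer.Theorems.BiquadraticEisensteinDescentHeegnerTwistCouplingInSupplySizeIndivisibleSharp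
  (classNumber_lt_of_sqrt_mul_log_lt)
open Summit.BirchSwinnertonDyer.BirchSwinnertonDyer.Theorems.BiquadraticEisensteinDescentHeegnerTwistCouplingInSupplyPartnerTables
  (jacobiSym_eq_one_of_table)
open Summit.BirchSwinnertonDyer.BirchSwinnertonDyer.Theorems.BiquadraticEisensteinDescentHeegnerTwistCouplingInSupplyPartnerLadder
  (jacobiSym_eq_neg_one_of_table_one_mod_four classNumber_lt_of_count exists_witnessField_of jacobiSym_neg_mul_eq_one)
open Summit.BirchSwinnertonDyer.BirchSwinnertonDyer.Theorems.BiquadraticEisensteinDescentHeegnerTwistCouplingInSupplyRoundingPin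
  (exists_cellPair_bound)
open Summit.BirchSwinnertonDyer.BirchSwinnertonDyer.Theorems.BiquadraticEisensteinDescentHeegnerTwistCouplingInSupplyPartnerLadderRungs
  (partnersL_spec)
open Summit.BirchSwinnertonDyer.BirchSwinnertonDyer.Theorems.BiquadraticEisensteinDescentHeegnerTwistCouplingInSupplyCornersThreeFacts
  (eq_two_or_eq_of_prime_dvd_conductorNorm_p)
open Summit.BirchSwinnertonDyer.BirchSwinnertonDyer.Theorems.BiquadraticEisensteinDescentHeegnerTwistCouplingInSupplyCornersEpOneFact
  (L_one_ne_zero_congruent)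

/-! ## §1 The class-number-formula lever at `|d| = O(p^{3/2})` -/

/-- **Size lever at `|d| ≤ B⁶·p^{3/2}`.** For real `0 < x ≤ B⁶·p·√p`, `0 < B`, `0 < T`, `T⁴ ≤ p` and the threshold condition
`6 < (3.14159/B⁴ − 0.8121)·(B·T)`: `π⁻¹·√x·log x < p`. Proof: with `t = p^{1/4}`, `w = B·t ≥ B·T`: `x ≤ w⁶`, `√x ≤ w³`,
`log x ≤ 6 log w ≤ 6(w/e² + 1)` (tangent of `log` at `e²`), so `√x log x ≤ 6w⁴/e² + 6w³ < π w⁴/B⁴ = π p` as soon as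
`6 < (π/B⁴ − 6/e²)·w`, and `π > 3.14159`, `6/e² < 0.8121`. [folklore] -/
theorem inv_pi_mul_sqrt_mul_log_lt_of_le_pow_six {x B T : ℝ} {p : ℕ} (hx : 0 < x) (hB : 0 < B) (hT : 0 < T)
    (hX : x ≤ B ^ 6 * (p : ℝ) * Real.sqrt p) (hK : 6 < (3.14159 / B ^ 4 - 0.8121) * (B * T))
    (hTp : T ^ 4 ≤ (p : ℝ)) : Real.pi⁻¹ * Real.sqrt x * Real.log x < p := by
  have hp0 : (0 : ℝ) < p := lt_of_lt_of_le (by positivity) hTp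
  have hπ : (0 : ℝ) < Real.pi := Real.pi_pos
  rcases le_or_gt x 1 with hx1 | hx1
  · have hlog : Real.log x ≤ 0 := Real.log_nonpos hx.le hx1
    have : Real.pi⁻¹ * Real.sqrt x * Real.log x ≤ 0 := mul_nonpos_of_nonneg_of_nonpos (by positivity) hlog
    linarith
  -- `t = p^{1/4}`, `w = B·t`
  set u : ℝ := Real.sqrt p with hu
  set t : ℝ := Real.sqrt u with ht
  have hu0 : 0 ≤ u := Real.sqrt_nonneg _
  have ht0 : 0 ≤ t := Real.sqrt_nonneg _
  have hu2 : u ^ 2 = p := Real.sq_sqrt hp0.le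
  have ht2 : t ^ 2 = u := Real.sq_sqrt hu0
  have ht4 : t ^ 4 = p := by rw [show t ^ 4 = (t ^ 2) ^ 2 by ring, ht2, hu2]
  have hTt : T ≤ t := by
    by_contra h
    push Not at h
    have : t ^ 4 < T ^ 4 := pow_lt_pow_left₀ h ht0 (by norm_num)
    linarith
  have ht0' : 0 < t := hT.trans_le hTt
  set w : ℝ := B * t with hw
  have hw0 : 0 < w := mul_pos hB ht0'
  have hxw : x ≤ w ^ 6 := by
    calc x ≤ B ^ 6 * p * Real.sqrt p := hX
      _ = B ^ 6 * t ^ 4 * t ^ 2 := by rw [ht4, ht2]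
      _ = w ^ 6 := by rw [hw]; ring
  have hsqrt : Real.sqrt x ≤ w ^ 3 := by
    rw [show w ^ 3 = Real.sqrt ((w ^ 3) ^ 2) from (Real.sqrt_sq (by positivity)).symm]
    exact Real.sqrt_le_sqrt (by nlinarith [hxw])
  have hlogx : Real.log x ≤ 6 * Real.log w := by
    have h := Real.log_le_log hx hxw
    rwa [Real.log_pow] at h
  set E : ℝ := Real.exp 1 with hE
  have hE0 : 0 < E := Real.exp_pos 1
  have hlogw : Real.log w ≤ w / E ^ 2 + 1 := by
    have h := Real.log_le_sub_one_of_pos (show 0 < w / E ^ 2 by positivity)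
    rw [Real.log_div hw0.ne' (by positivity), Real.log_pow, hE, Real.log_exp] at h
    linarith
  have hlogx0 : 0 < Real.log x := Real.log_pos hx1
  have h1 : Real.sqrt x * Real.log x ≤ w ^ 3 * (6 * (w / E ^ 2 + 1)) :=
    mul_le_mul hsqrt (by linarith) hlogx0.le (by positivity)
  -- constants: `π > 3.14159`, `6/e² < 0.8121`
  have hπ' : (3.14159 : ℝ) < Real.pi := lt_trans (by norm_num) Real.pi_gt_d6
  have hE' : (2.7182818283 : ℝ) < E := Real.exp_one_gt_d9
  have hE2 : (6 : ℝ) < 0.8121 * E ^ 2 := by nlinarith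
  have hcoef : 3.14159 / B ^ 4 - 0.8121 ≤ Real.pi / B ^ 4 - 6 / E ^ 2 := by
    have h₁ : 3.14159 / B ^ 4 < Real.pi / B ^ 4 := div_lt_div_of_pos_right hπ' (by positivity)
    have h₂ : 6 / E ^ 2 < 0.8121 := by rw [div_lt_iff₀ (by positivity)]; linarith
    linarith
  have hc0 : 0 < 3.14159 / B ^ 4 - 0.8121 := by
    by_contra h
    push Not at h
    have : (3.14159 / B ^ 4 - 0.8121) * (B * T) ≤ 0 := mul_nonpos_of_nonpos_of_nonneg h (by positivity)
    linarith
  have hkey : 6 < (Real.pi / B ^ 4 - 6 / E ^ 2) * w := by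
    calc (6 : ℝ) < (3.14159 / B ^ 4 - 0.8121) * (B * T) := hK
      _ ≤ (3.14159 / B ^ 4 - 0.8121) * (B * t) := by gcongr
      _ ≤ (Real.pi / B ^ 4 - 6 / E ^ 2) * w := by rw [hw]; exact mul_le_mul_of_nonneg_right hcoef (by positivity)
  have hB4 : 0 < B ^ 4 := by positivity
  have hp' : (p : ℝ) = w ^ 4 / B ^ 4 := by
    rw [hw, mul_pow, ← ht4]
    field_simp
  have h2 : w ^ 3 * (6 * (w / E ^ 2 + 1)) < Real.pi * p := by
    have hw3 : 0 < w ^ 3 := by positivity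
    have h3 : 6 * w ^ 3 < (Real.pi / B ^ 4 - 6 / E ^ 2) * w * w ^ 3 := by nlinarith
    have expand : (Real.pi / B ^ 4 - 6 / E ^ 2) * w * w ^ 3 = Real.pi * (w ^ 4 / B ^ 4) - 6 * w ^ 4 / E ^ 2 := by ring
    calc w ^ 3 * (6 * (w / E ^ 2 + 1)) = 6 * w ^ 4 / E ^ 2 + 6 * w ^ 3 := by ring
      _ < Real.pi * (w ^ 4 / B ^ 4) := by linarith
      _ = Real.pi * p := by rw [hp']
  calc Real.pi⁻¹ * Real.sqrt x * Real.log x = Real.pi⁻¹ * (Real.sqrt x * Real.log x) := by ring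
    _ ≤ Real.pi⁻¹ * (w ^ 3 * (6 * (w / E ^ 2 + 1))) := mul_le_mul_of_nonneg_left h1 (by positivity)
    _ < Real.pi⁻¹ * (Real.pi * p) := mul_lt_mul_of_pos_left h2 (by positivity)
    _ = p := by field_simp

/-- **The lever at the rounding bound.** For naturals `0 < n`, `p ≥ 1400`, `s` with `s² ≤ 2p` and `7n ≤ (3p + 4s + 4)(4s + 1)`:
`π⁻¹·√n·log n < p` (`n ≤ 2.55·p^{3/2} ≤ 1.172⁶·p^{3/2}` for `p ≥ 1400`; instance `B = 1.172`, `T = 6.06`, `T⁴ = 1348.6…`).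
[folklore] -/
theorem inv_pi_mul_sqrt_mul_log_lt_of_rounding_bound {n p s : ℕ} (hn : 0 < n)
    (h7 : 7 * n ≤ (3 * p + 4 * s + 4) * (4 * s + 1)) (hss : s * s ≤ 2 * p) (hp : 1400 ≤ p) :
    Real.pi⁻¹ * Real.sqrt n * Real.log n < p := by
  have hp' : (1400 : ℝ) ≤ p := by exact_mod_cast hp
  refine inv_pi_mul_sqrt_mul_log_lt_of_le_pow_six (B := 1.172) (T := 6.06) (by exact_mod_cast hn) (by norm_num)
    (by norm_num) ?_ (by norm_num) (le_trans (by norm_num) hp')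
  set u : ℝ := Real.sqrt p with hu
  have hp0 : (0 : ℝ) ≤ p := by positivity
  have hu0 : 0 ≤ u := Real.sqrt_nonneg _
  have hu2 : u ^ 2 = p := Real.sq_sqrt hp0
  have hu37 : (37.41 : ℝ) ≤ u := by
    rw [hu]
    exact Real.le_sqrt_of_sq_le (by linarith)
  have hs0 : (0 : ℝ) ≤ s := by positivity
  have hsu : (s : ℝ) ≤ 1.41422 * u := by
    have h1 : (s : ℝ) * s ≤ 2 * p := by exact_mod_cast hss
    have h2 : (s : ℝ) ^ 2 < (1.41422 * u) ^ 2 := by nlinarith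
    exact le_of_lt (lt_of_pow_lt_pow_left₀ 2 (by positivity) h2)
  have h7' : 7 * (n : ℝ) ≤ (3 * (p : ℝ) + 4 * s + 4) * (4 * s + 1) := by exact_mod_cast h7
  have hmono : (3 * (p : ℝ) + 4 * s + 4) * (4 * s + 1) ≤ (3 * (p : ℝ) + 4 * (1.41422 * u) + 4) * (4 * (1.41422 * u) + 1) := by
    gcongr
  have hpoly : (3 * (p : ℝ) + 4 * (1.41422 * u) + 4) * (4 * (1.41422 * u) + 1) ≤ 7 * ((1.172 : ℝ) ^ 6 * p * u) := by
    rw [← hu2]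
    nlinarith [mul_nonneg (mul_nonneg hu0 hu0) (sub_nonneg.2 hu37), mul_nonneg hu0 (sub_nonneg.2 hu37)]
  linarith

/-- **`h(K) < p` for every imaginary quadratic `K` of discriminant `−qℓ`** when `7·qℓ ≤ (3p + 4s + 4)(4s + 1)`, `s² ≤ 2p`,
`p ≥ 1400` (Oesterlé's `h ≤ π⁻¹√|d| log|d|`, tree `classNumber_lt_of_sqrt_mul_log_lt`). [cite: Oesterle1988Gauss, II §3 Proposition p. 57 (27)] -/
theorem classNumber_lt_of_rounding_bound {p q l s : ℕ} (hq : q.Prime) (hl : l.Prime) (hl8 : l % 8 = 5)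
    (h7 : 7 * (q * l) ≤ (3 * p + 4 * s + 4) * (4 * s + 1)) (hss : s * s ≤ 2 * p) (hp : 1400 ≤ p) :
    ∀ (K : Type) [Field K] [NumberField K], IsImaginaryQuadratic K →
      NumberField.discr K = -((q * l : ℕ) : ℤ) → NumberField.classNumber K < p := by
  intro K _ _ hK hdK
  have h4 : 4 < (NumberField.discr K).natAbs := by
    rw [hdK, Int.natAbs_neg, Int.natAbs_natCast]
    have := hq.two_le
    have : 5 ≤ l := by have := hl.two_le; omega
    nlinarith
  refine classNumber_lt_of_sqrt_mul_log_lt hK h4 ?_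
  rw [hdK, Int.natAbs_neg, Int.natAbs_natCast]
  exact inv_pi_mul_sqrt_mul_log_lt_of_rounding_bound (Nat.mul_pos hq.pos hl.pos) h7 hss hp

/-! ## §2 Kernel table below `1400` -/

/-- The partner primes of the table: `q ∈ {3, 11, 19, 43, 59, 67, 83}` are primes `≡ 3 (mod 8)`. [folklore] -/
theorem tableQs_spec : ∀ q ∈ [3, 11, 19, 43, 59, 67, 83], q.Prime ∧ q % 8 = 3 := by
  decide +kernel

/-- **Kernel table, `p < 700`.** For EVERY `p ≡ 7 (mod 8)` below `700` (prime or not): partners `q ∈ {3, 11, 19, 43, 59, 67, 83}`,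
`ℓ ∈ {5, 13, 29, 37, 53, 61}` with `p` a non-residue mod `q` and mod `ℓ`, and `h(−qℓ) < p` by Cohen's pair counter. One `decide +kernel`.
[cite: Cohen1993, §5.3.1 Algorithm 5.3.5] -/
theorem tableLow : ∀ p ∈ Finset.range 700, p % 8 = 7 →
    ∃ q ∈ [3, 11, 19, 43, 59, 67, 83], ∃ l ∈ [5, 13, 29, 37, 53, 61],
      (∀ x < q, x * x % q ≠ p % q) ∧ (∀ x < l, x * x % l ≠ p % l) ∧ BinQF.classNumberCount (q * l) < p := by
  decide +kernel

/-- **Kernel table, `700 ≤ p < 1400`.** Same rows for `p ≡ 7 (mod 8)` in `[700, 1400)`. [cite: Cohen1993, §5.3.1 Algorithm 5.3.5] -/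
theorem tableHigh : ∀ p ∈ Finset.range 1400, 700 ≤ p → p % 8 = 7 →
    ∃ q ∈ [3, 11, 19, 43, 59, 67, 83], ∃ l ∈ [5, 13, 29, 37, 53, 61],
      (∀ x < q, x * x % q ≠ p % q) ∧ (∀ x < l, x * x % l ≠ p % l) ∧ BinQF.classNumberCount (q * l) < p := by
  decide +kernel

/-- **Cell data below `1400` (kernel table).** For every `p ≡ 7 (mod 8)`, `p < 1400`: primes `q ≡ 3`, `ℓ ≡ 5 (mod 8)` with `(q/p) = +1`,
`(ℓ/p) = −1` and `h(K) < p` for every imaginary quadratic `K` of discriminant `−qℓ`. [cite: Cohen1993, §5.3.1 Algorithm 5.3.5] -/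
theorem exists_cellData_p_of_lt {p : ℕ} (hp8 : p % 8 = 7) (hlt : p < 1400) :
    ∃ q l : ℕ, q.Prime ∧ q % 8 = 3 ∧ l.Prime ∧ l % 8 = 5 ∧ jacobiSym (q : ℤ) p = 1 ∧ jacobiSym (l : ℤ) p = -1 ∧
      ∀ (K : Type) [Field K] [NumberField K], IsImaginaryQuadratic K →
        NumberField.discr K = -((q * l : ℕ) : ℤ) → NumberField.classNumber K < p := by
  obtain ⟨q, hqmem, l, hlmem, hresq, hresl, hh⟩ :
      ∃ q ∈ [3, 11, 19, 43, 59, 67, 83], ∃ l ∈ [5, 13, 29, 37, 53, 61],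
        (∀ x < q, x * x % q ≠ p % q) ∧ (∀ x < l, x * x % l ≠ p % l) ∧ BinQF.classNumberCount (q * l) < p := by
    rcases Nat.lt_or_ge p 700 with h | h
    · exact tableLow p (Finset.mem_range.mpr h) hp8
    · exact tableHigh p (Finset.mem_range.mpr hlt) h hp8
  obtain ⟨hq, hq8⟩ := tableQs_spec q hqmem
  obtain ⟨hl, hl8⟩ := partnersL_spec l hlmem
  exact ⟨q, l, hq, hq8, hl, hl8, jacobiSym_eq_one_of_table hq (by omega) hq8 hresq,
    jacobiSym_eq_neg_one_of_table_one_mod_four hl (by omega) (by omega) hresl, classNumber_lt_of_count hq hl hh⟩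

/-! ## §3 ★ Cell data for EVERY prime `p ≡ 7 (mod 8)` -/

/-- **Cell data above `1400` (rounding pin).** For every prime `p ≡ 7 (mod 8)`, `p ≥ 1400`: primes `q ≡ 3`, `ℓ ≡ 5 (mod 8)` with
`(q/p) = +1`, `(ℓ/p) = −1` and `h(K) < p` for every imaginary quadratic `K` of discriminant `−qℓ` (`…RoundingPin.exists_cellPair_bound`:
`7qℓ ≤ (3p + 4⌊√2p⌋ + 4)(4⌊√2p⌋ + 1)`; then §1). [cite: Oesterle1988Gauss, II §3 Proposition p. 57 (27)] -/
theorem exists_cellData_p_of_le {p : ℕ} (hp : p.Prime) (hp8 : p % 8 = 7) (h1400 : 1400 ≤ p) :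
    ∃ q l : ℕ, q.Prime ∧ q % 8 = 3 ∧ l.Prime ∧ l % 8 = 5 ∧ jacobiSym (q : ℤ) p = 1 ∧ jacobiSym (l : ℤ) p = -1 ∧
      ∀ (K : Type) [Field K] [NumberField K], IsImaginaryQuadratic K →
        NumberField.discr K = -((q * l : ℕ) : ℤ) → NumberField.classNumber K < p := by
  obtain ⟨q, l, hq, hq8, hl, hl8, hJq, hJl, h7⟩ := exists_cellPair_bound hp hp8
  exact ⟨q, l, hq, hq8, hl, hl8, hJq, hJl, classNumber_lt_of_rounding_bound hq hl hl8 h7 (Nat.sqrt_le (2 * p)) h1400⟩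

/-- ★ **CELL DATA FOR EVERY PRIME `p ≡ 7 (mod 8)`** — the statement of `…CornersThreeFacts.exists_cellData_p` with its residue-class
hypothesis `hcase` DELETED: primes `q ≡ 3 (mod 8)`, `ℓ ≡ 5 (mod 8)` with `(q/p) = +1`, `(ℓ/p) = −1` and `h(K) < p` for every imaginary
quadratic `K` of discriminant `−qℓ`. UNCONDITIONAL (rounding pin above `1400`, kernel table below). [cite: Oesterle1988Gauss, II §3 Proposition p. 57 (27)]
[cite: Cohen1993, §5.3.1 Algorithm 5.3.5] -/
theorem exists_cellData_p_all {p : ℕ} (hp : p.Prime) (hp8 : p % 8 = 7) :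
    ∃ q l : ℕ, q.Prime ∧ q % 8 = 3 ∧ l.Prime ∧ l % 8 = 5 ∧ jacobiSym (q : ℤ) p = 1 ∧ jacobiSym (l : ℤ) p = -1 ∧
      ∀ (K : Type) [Field K] [NumberField K], IsImaginaryQuadratic K →
        NumberField.discr K = -((q * l : ℕ) : ℤ) → NumberField.classNumber K < p := by
  rcases Nat.lt_or_ge p 1400 with h | h
  · exact exists_cellData_p_of_lt hp8 h
  · exact exists_cellData_p_of_le hp hp8 h

/-! ## §4 ★★ The corner `W = E_p` for EVERY prime `p ≡ 7 (mod 8)`, modulo Burungale–Tian only -/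

/-- ★★ **THE CORNER `W = E_p` FOR EVERY PRIME `p ≡ 7 (mod 8)`, ONE NAMED FACT.** Modulo Burungale–Tian's rank-zero `2`-converse for CM
curves ONLY: for every prime `p ≡ 7 (mod 8)` there is an imaginary quadratic field `K′` with `4 < |d_{K′}|`, Heegner for `N(E_p)`,
`L(E_p^{(d_{K′})}, 1) ≠ 0`, `h(K′) < p` and `p ∤ h(K′)` — the conclusion of crux `HeegnerTwistCouplingInSupply` on `W = E_p`. This is
`…CornersEpOneFact.cruxOnEpCorner_of_BT` with its residue-class hypothesis DELETED (cell data `exists_cellData_p_all`; the `2`-descent of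
`E_{pqℓ}`, the witness field `ℚ(√−qℓ)` and the support of `N(E_p)` by name). [cite: BurungaleTian2026, Thm. 1.1]
[cite: SilvermanAEC2009, Prop. X.4.9 and Thm. X.4.2(a)] [cite: Oesterle1988Gauss, II §3 Proposition p. 57 (27)] -/
theorem cruxOnEpCornerAllP_of_BT (hBT : burungaleTian_analyticRank_eq_zero_of_selmerCorank_eq_zero_of_hasCM) :
    ∀ (p : ℕ) [Fact p.Prime] [(congruentNumberCurve p).IsElliptic] [(congruentNumberCurve p).IsGloballyMinimal]
      [NeZero ((congruentNumberCurve p).conductorNorm ℤ)],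
      p % 8 = 7 →
      ∃ (K : Type) (_ : Field K) (_ : NumberField K),
        IsImaginaryQuadratic K ∧ 4 < (NumberField.discr K).natAbs ∧
        SatisfiesHeegnerHypothesis ((congruentNumberCurve p).conductorNorm ℤ) K ∧
        ((congruentNumberCurve p).quadraticTwist (NumberField.discr K : ℚ)).entireLFunction 1 ≠ 0 ∧
        NumberField.classNumber K < p ∧ ¬ p ∣ NumberField.classNumber K := by
  intro p hpF _ _ _ hp8
  have hp : p.Prime := hpF.out
  have hp4 : p % 4 = 3 := by omega
  obtain ⟨q, l, hq, hq8, hl, hl8, hJq, hJl, hh⟩ := exists_cellData_p_all hp hp8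
  obtain ⟨K, iF, iN, hK, hdK, hH', hcl⟩ := exists_witnessField_of (N := (congruentNumberCurve p).conductorNorm ℤ)
    hq hq8 hl hl8 (jacobiSym_neg_mul_eq_one hp4 hJq hJl) hh (fun r hr hrN => eq_two_or_eq_of_prime_dvd_conductorNorm_p hp hr hrN)
  refine ⟨K, iF, iN, hK, ?_, hH', ?_, hcl, fun hdvd => absurd (Nat.le_of_dvd (NumberField.classNumber_pos K) hdvd) (not_le.mpr hcl)⟩
  · rw [hdK, Int.natAbs_neg, Int.natAbs_natCast]
    have h3 : 3 ≤ q := by have := hq.two_le; omega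
    have h5 : 5 ≤ l := by have := hl.two_le; omega
    calc 4 < 3 * 5 := by norm_num
      _ ≤ q * l := Nat.mul_le_mul h3 h5
  · rw [hdK, quadraticTwist_congruentNumberCurve, Int.natAbs_neg, Int.natAbs_natCast, ← mul_assoc]
    haveI := isElliptic_congruentNumberCurve (Nat.mul_ne_zero (Nat.mul_ne_zero hp.ne_zero hq.ne_zero) hl.ne_zero)
    exact (L_one_ne_zero_congruent hBT hp hq hl hp8 hq8 hl8 hJq hJl).2

/-- ★★ **The same corner with NO side binders**: for every prime `p ≡ 7 (mod 8)` — `E_p : y² = x³ − p²x` being an elliptic curve, a global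
minimal model (`isGloballyMinimal_congruentNumberCurve`, `p` square-free) with `N(E_p) ≠ 0` (`conductorNorm_pos_holds`) — modulo Burungale–Tian
ONLY there is a Heegner field `K′` of `N(E_p)` with `4 < |d_{K′}|`, `L(E_p^{(d_{K′})}, 1) ≠ 0`, `h(K′) < p`, `p ∤ h(K′)`. An honest closed
statement; the crux itself (all CM `W`) is NOT claimed. [cite: BurungaleTian2026, Thm. 1.1] [cite: Oesterle1988Gauss, II §3 Proposition p. 57 (27)] -/
theorem cruxOnEpCornerAllP (hBT : burungaleTian_analyticRank_eq_zero_of_selmerCorank_eq_zero_of_hasCM) :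
    ∀ (p : ℕ) [Fact p.Prime], p % 8 = 7 →
      haveI := isElliptic_congruentNumberCurve (Fact.out : p.Prime).ne_zero
      ∃ (K : Type) (_ : Field K) (_ : NumberField K),
        IsImaginaryQuadratic K ∧ 4 < (NumberField.discr K).natAbs ∧
        SatisfiesHeegnerHypothesis ((congruentNumberCurve p).conductorNorm ℤ) K ∧
        ((congruentNumberCurve p).quadraticTwist (NumberField.discr K : ℚ)).entireLFunction 1 ≠ 0 ∧
        NumberField.classNumber K < p ∧ ¬ p ∣ NumberField.classNumber K := by
  intro p hpF hp8
  have hp : p.Prime := hpF.out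
  haveI := isElliptic_congruentNumberCurve hp.ne_zero
  haveI := isGloballyMinimal_congruentNumberCurve hp.squarefree
  haveI : NeZero ((congruentNumberCurve p).conductorNorm ℤ) := ⟨((congruentNumberCurve p).conductorNorm_pos_holds).ne'⟩
  exact cruxOnEpCornerAllP_of_BT hBT p hp8

end Summit.BirchSwinnertonDyer.BirchSwinnertonDyer.Theorems.BiquadraticEisensteinDescentHeegnerTwistCouplingInSupplyRoundingPinCellData

end
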